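import Summits.AtomisticToContinuum.BoseEinsteinCondensation.Theses.BECBoundaryReservoir

/-!
# Birth skeleton (BC3) for crux `BECBoundaryReservoir.ReservoirRemoval`

Item `stmt-AtomisticToContinuum-8768`, route `route-AtomisticToContinuum-BECBoundaryReservoir`
(sub-problem `BoseEinsteinCondensation`); registrar seat
`planner-skel-stmt-AtomisticToContinuum-8768-0`, 2026-08-17. Published as
`Cruxes/ReservoirRemoval/Lines/birth.lean`; line card `Lines/birth.md`.

Crux (fixed, by name): `ReservoirRemoval` — for every repulsive finite-range `v` there is
`ρ₀ > 0` such that for ALL `0 < ρ < ρ₀`, `w > 0`, `κ > 0`: if the `δ`-near-minimisers of the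
shell-pinned functional `F_κ(Ψ) = energy v Ψ + κ (N - ⟨g, γ_Ψ g⟩)` (`g` = normalised indicator of
the boundary shell of width `w` of the box of side `L = (N/ρ)^{1/3}`) eventually have
`λ_max(γ_Ψ) ≥ cN` for some `c > 0`, then `HasGroundStateBEC v ρ` (bare Dirichlet ground state).

## The line: bounded reservoir / overfilled reservoir (dichotomy on the core of `v`)

Write `PinnedBEC(v,ρ,w,κ,c)` for the antecedent of the crux and `BoundedReservoir(v,ρ,w,κ)` for
"∃ C, eventually every `δ`-near-minimiser of `F_κ` has reservoir occupation
`⟨g, γ_Ψ g⟩ ≤ C·L²`" (the route's own Numbers section: reservoir occupation `≈ ρ_sh |S_w| =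
O(N^{2/3})`, "never macroscopic by itself"). Three stubs:

* `stub_boundedReservoirRemoval` — THE HEART (the crux's intended content, size XL, open):
  `BoundedReservoir → PinnedBEC(c) → HasGroundStateBEC v ρ` at every `ρ < ρ₀(v)`, every `w, κ`.
  "Removing an `O(L²)`-occupied boundary reservoir does not destroy a bulk condensate."
  Why it might fail: the route's own (pinned and bare ground states differ by an `O(L²)` wall
  energy ≫ any gap; energy-only transfer is DEAD at this scale because `O(L²)`-near-minimisers of
  the bare energy include fragmented cat states, `BoseGasCatStates.exists_fragmented_trialState`
  with `m² ≈ L`; so the transfer must use structure — positivity / uniqueness of both ground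
  states, both Hamiltonians being stoquastic since `g ≥ 0`).
* `stub_reservoirCapacity` — RESERVOIR CAPACITY (size L, plausibly provable with cell-method
  lower bounds): if `v` is NOT hollow-core (not a.e. zero on any `(0, r₀)`), then at small density
  `BoundedReservoir(v,ρ,w,κ)` holds for all `w, κ > 0`. Mechanism: `⟨g,γg⟩ ≤ n_S` (expected
  number in the shell, Cauchy–Schwarz); an overfilled shell (`n_S ≫ L²`, i.e. shell density
  `→ ∞`) costs energy per particle `≳ e(ρ_sh)/1 ≥ (e(ρ₁)/ρ₁) ρ_sh → ∞` (convexity of the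
  thermodynamic energy density, `e(ρ₁) > 0` as soon as `∫_{B(0,r)} v > 0` for all `r`, i.e. a
  positive scattering length and no interaction-free piling up), which beats the fixed gain `κ`
  per particle; for hard cores it is mere packing (`n_S ≤ C w L²/a³` pointwise on finite-energy
  configurations, `BoseGasHardSet.eq_zero_of_sub_mem_hardVec`). Variationally: capacity at `2κ`,
  `R_{2κ} ≥ E₀ + 2κN - C L²`, and near-minimality at `κ`, `F_κ(Ψ) ≤ E₀ + κN + δ`, subtract to
  `κ⟨g,γ_Ψ g⟩ ≤ C L² + δ`.
* `stub_hollowCoreCondensation` — THE RESIDUE (= the summit conjunct restricted to HOLLOW-CORE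
  potentials, `v = 0` a.e. on some `(0, r₀)`; conjectural, XL). It is FORCED: the crux as typed
  IMPLIES it (`hollowCoreCondensation_of_reservoirRemoval` below, sorry-free modulo the paper
  lemma `CombSaturation`): for hollow-core `v`, any `w > 0` and `κ ≥ κ_c(v,w)`, the COMB trial
  state — all `N` particles condensed in `u = m^{-1/2} ∑_j φ_r(· - ξ_j)`, `φ_r` a normalised `C¹`
  bump of radius `r < min(r₀, w)/2`, centres `ξ_j` in the shell at mutual distance `≥ R₀ + 2r`
  (`R₀` the range of `v`) — has ZERO interaction (intra-cluster distances `< r₀` where `v = 0`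
  a.e., inter-cluster distances `> R₀` where `v = 0`), kinetic energy `N‖∇φ_r‖²` and reservoir
  occupation `⟨g, γ g⟩ = N|⟨g,u⟩|² ≥ f·N` with the packing fraction
  `f = (m/|S_w|)(∫φ_r)² > 0` independent of `N` (`m ≍ L²` centres; `f ≈ 0.8·(4π/3) r³/(R₀+2r)³`
  when `w ≫ R₀`); hence `inf F_κ ≤ N(‖∇φ_r‖² + κ(1-f))`, and
  every `1`-near-minimiser `Ψ` has `κ⟨g,γ_Ψ g⟩ ≥ (κ f - ‖∇φ_r‖²)N - 1 ≥ κ f N/2` once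
  `κ ≥ 4‖∇φ_r‖²/f`, so `λ_max(γ_Ψ) ≥ ⟨g,γ_Ψ g⟩ ≥ (f/2)N` (`occupation_le_maxOccupation`, `g`
  normalised for `L > 2w`): the antecedent of the crux is PROVABLY TRUE there, and its conclusion
  is dilute BEC for `v`. So no proof of `ReservoirRemoval` as typed can avoid proving dilute BEC
  for every hollow-core admissible `v` (e.g. `v = 1_{[1,2]}`); the skeleton names that debt
  instead of hiding it. RESTATE RECOMMENDED to the route's tenure planner (see `birth.md`): add the
  bounded-reservoir clause `occupation (n+1) g Ψ.ψ ≤ ENNReal.ofReal (C * L ^ 2)` to the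
  near-minimiser hypothesis of `ReservoirRemoval` (and to the conclusion of `ShellPenetration`,
  whose intended regime `8πaρ < κ ≪ a⁻²` has it); then the residue and the capacity stub drop out
  and the crux IS `stub_boundedReservoirRemoval`.

ASSEMBLY (`ReservoirRemoval_of`, sorry-free, pure logic): given admissible `v`, `by_cases` on
`HollowCore v`; hollow ⇒ the residue gives `ρ₀` and the conclusion outright; not hollow ⇒
`ρ₀ = min ρ₁ ρ₂`, capacity gives `BoundedReservoir`, the heart gives `HasGroundStateBEC v ρ`.

Disproof.lean for this crux: none exists (`ledger crux ls stmt-AtomisticToContinuum-8768`: no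
workfiles, 2026-08-17); negatives index of the summit (20 items) has no pinning / reservoir
statement. The comb theorem above is NEW disproof-side knowledge (crux ⟹ summit fragment), recorded
here and in `birth.md` for the standing disprover.
-/

noncomputable section

open MeasureTheory Filter
open scoped ENNReal NNReal ComplexConjugate

namespace Summit.AtomisticToContinuum.BoseEinsteinCondensation.Cruxes.ReservoirRemoval.Birth

open Literature.MathematicalPhysics.QuantumManyBody.BoseGas
open Summit.AtomisticToContinuum.BoseEinsteinCondensation.Theses.BECBoundaryReservoir

set_option linter.unusedVariables false

/-! ## §0 Vocabulary (inline, over existing declarations only) -/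

/-- **Hollow core**: the pair potential vanishes almost everywhere on a neighbourhood of the
origin, `v = 0` a.e. on `(0, r₀)` for some `r₀ > 0` (e.g. `v = 0`, `v = 1_{[1,2]}`, smooth bumps
supported on annuli; NOT hard or soft spheres). Exactly the class on which bosons can pile up in
interaction-free clusters, so that a rank-one pinning of fixed strength can condense a MACROSCOPIC
fraction of the gas into the boundary shell (the comb, module docstring). Stronger than "no hard
core" of `BoseGasNoHardCore` (arbitrarily small integrable relative positions). [folklore] -/
def HollowCore (v : ℝ → ℝ≥0∞) : Prop :=
  ∃ r₀ : ℝ, 0 < r₀ ∧ ∀ᵐ r : ℝ, r ∈ Set.Ioo 0 r₀ → v r = 0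

/-- **Bounded reservoir** at `(v, ρ, w, κ)`: there is `C` such that for all large `N = n + 1`
(`L = (N/ρ)^{1/3}`, `g` the normalised indicator of the boundary shell of width `w` — verbatim the
crux's `g`) and some slack `δ > 0`, every `δ`-near-minimiser `Ψ` of the pinned functional
`energy v Ψ + κ(N - ⟨g, γ_Ψ g⟩)` has reservoir occupation `⟨g, γ_Ψ g⟩ ≤ C · L²`
(the route's Numbers: `⟨g,γg⟩ ≈ ρ_sh |S_w| = O(N^{2/3})`). [folklore] -/
def BoundedReservoir (v : ℝ → ℝ≥0∞) (ρ w κ : ℝ) : Prop :=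
  ∃ C : ℝ, ∀ᶠ n : ℕ in Filter.atTop, ∃ δ : ENNReal, 0 < δ ∧ let L : ℝ := sideLength ρ (n + 1); let g : EuclideanSpace ℝ (Fin 3) → ℂ := Set.indicator {x | (∀ k, x k ∈ Set.Ioo 0 L) ∧ ∃ k, x k ≤ w ∨ L - w ≤ x k} (fun _ => ((Real.sqrt (L ^ 3 - (L - 2 * w) ^ 3))⁻¹ : ℂ)); ∀ Ψ : TrialState (n + 1) L, energy v Ψ + ENNReal.ofReal κ * ((n + 1 : ENNReal) - occupation (n + 1) g Ψ.ψ) ≤ (⨅ Φ : TrialState (n + 1) L, energy v Φ + ENNReal.ofReal κ * ((n + 1 : ENNReal) - occupation (n + 1) g Φ.ψ)) + δ → occupation (n + 1) g Ψ.ψ ≤ ENNReal.ofReal (C * L ^ 2)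

/-- **Pinned BEC** at `(v, ρ, w, κ)` with constant `c`: VERBATIM the body of the crux's
antecedent — eventually in `N = n + 1`, for some `δ > 0`, every `δ`-near-minimiser of the
shell-pinned functional has `λ_max(γ_Ψ) ≥ cN`. [folklore] -/
def PinnedBEC (v : ℝ → ℝ≥0∞) (ρ w κ c : ℝ) : Prop :=
  ∀ᶠ n : ℕ in Filter.atTop, ∃ δ : ENNReal, 0 < δ ∧ let L : ℝ := sideLength ρ (n + 1); let g : EuclideanSpace ℝ (Fin 3) → ℂ := Set.indicator {x | (∀ k, x k ∈ Set.Ioo 0 L) ∧ ∃ k, x k ≤ w ∨ L - w ≤ x k} (fun _ => ((Real.sqrt (L ^ 3 - (L - 2 * w) ^ 3))⁻¹ : ℂ)); ∀ Ψ : TrialState (n + 1) L, energy v Ψ + ENNReal.ofReal κ * ((n + 1 : ENNReal) - occupation (n + 1) g Ψ.ψ) ≤ (⨅ Φ : TrialState (n + 1) L, energy v Φ + ENNReal.ofReal κ * ((n + 1 : ENNReal) - occupation (n + 1) g Φ.ψ)) + δ → ENNReal.ofReal (c * (n + 1)) ≤ maxOccupation (n + 1) Ψ.ψ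

/-- The crux is literally `∀ v admissible, ∃ ρ₀ > 0, ∀ ρ w κ in range, (∃ c > 0, PinnedBEC v ρ w κ c)
→ HasGroundStateBEC v ρ` (definitional unfolding; documents that `PinnedBEC` is verbatim). [folklore] -/
theorem reservoirRemoval_iff :
    ReservoirRemoval ↔ ∀ v : ℝ → ℝ≥0∞, IsRepulsiveFiniteRange v → ∃ ρ₀ : ℝ, 0 < ρ₀ ∧
      ∀ ρ w κ : ℝ, 0 < ρ → ρ < ρ₀ → 0 < w → 0 < κ →
        (∃ c : ℝ, 0 < c ∧ PinnedBEC v ρ w κ c) → HasGroundStateBEC v ρ :=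
  Iff.rfl

/-! ### The three pieces -/

/-- Piece 1 — **bounded-reservoir removal** (the heart; the crux's intended content): for every
admissible `v` there is `ρ₀ > 0` such that for all `0 < ρ < ρ₀`, `w, κ > 0`, IF the pinned
near-minimisers keep the reservoir occupation `O(L²)` AND have `λ_max ≥ cN`, THEN the bare
Dirichlet ground state at density `ρ` condenses. [conjecture-strength; size XL] -/
def BoundedReservoirRemoval : Prop :=
  ∀ v : ℝ → ℝ≥0∞, IsRepulsiveFiniteRange v → ∃ ρ₀ : ℝ, 0 < ρ₀ ∧
    ∀ ρ w κ : ℝ, 0 < ρ → ρ < ρ₀ → 0 < w → 0 < κ → BoundedReservoir v ρ w κ →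
      (∃ c : ℝ, 0 < c ∧ ∀ᶠ n : ℕ in Filter.atTop, ∃ δ : ENNReal, 0 < δ ∧ let L : ℝ := sideLength ρ (n + 1); let g : EuclideanSpace ℝ (Fin 3) → ℂ := Set.indicator {x | (∀ k, x k ∈ Set.Ioo 0 L) ∧ ∃ k, x k ≤ w ∨ L - w ≤ x k} (fun _ => ((Real.sqrt (L ^ 3 - (L - 2 * w) ^ 3))⁻¹ : ℂ)); ∀ Ψ : TrialState (n + 1) L, energy v Ψ + ENNReal.ofReal κ * ((n + 1 : ENNReal) - occupation (n + 1) g Ψ.ψ) ≤ (⨅ Φ : TrialState (n + 1) L, energy v Φ + ENNReal.ofReal κ * ((n + 1 : ENNReal) - occupation (n + 1) g Φ.ψ)) + δ → ENNReal.ofReal (c * (n + 1)) ≤ maxOccupation (n + 1) Ψ.ψ) →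
      HasGroundStateBEC v ρ

/-- Piece 2 — **reservoir capacity**: a potential that is NOT hollow-core (`v ≠ 0` on a
positive-measure subset of every `(0, r₀)`) cannot be piled into the shell beyond `O(L²)` particles
by a pinning of fixed strength: at small density, for every shell width and pinning strength the
near-minimisers of the pinned functional have bounded reservoir occupation. [size L] -/
def ReservoirCapacity : Prop :=
  ∀ v : ℝ → ℝ≥0∞, IsRepulsiveFiniteRange v → ¬ HollowCore v → ∃ ρ₀ : ℝ, 0 < ρ₀ ∧
    ∀ ρ w κ : ℝ, 0 < ρ → ρ < ρ₀ → 0 < w → 0 < κ → BoundedReservoir v ρ w κ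

/-- Piece 3 — **hollow-core condensation** (the residue): dilute ground-state BEC for every
admissible HOLLOW-CORE potential. This is the summit conjunct restricted to that class; it is
listed as a stub because the crux as typed IMPLIES it
(`hollowCoreCondensation_of_reservoirRemoval`), so no line for the crux can be weaker.
[conjecture; size XL] -/
def HollowCoreCondensation : Prop :=
  ∀ v : ℝ → ℝ≥0∞, IsRepulsiveFiniteRange v → HollowCore v → ∃ ρ₀ : ℝ, 0 < ρ₀ ∧
    ∀ ρ : ℝ, 0 < ρ → ρ < ρ₀ → HasGroundStateBEC v ρ

/-! ## §1 Stubs (`sorry` only here) -/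

/-- Stub 1 (heart, XL): bounded-reservoir removal. See `BoundedReservoirRemoval`.
[cite: LSSY2005, §1.2 (1.19) and Ch. 5; LebowitzMartinlof1972 (the Ising analogue
`⟨σ₀σ_x⟩^free = ⟨σ₀σ_x⟩^+`)] -/
theorem stub_boundedReservoirRemoval : BoundedReservoirRemoval := by
  sorry

/-- Stub 2 (capacity, L): non-hollow potentials have `O(L²)` reservoirs at every `(w, κ)` in the
dilute regime. See `ReservoirCapacity`. [cite: LSSY2005, Thm 2.4 (cell-method lower bound);
Ruelle1969, §3.5 (convexity of the energy density)] -/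
theorem stub_reservoirCapacity : ReservoirCapacity := by
  sorry

/-- Stub 3 (residue, XL / conjectural): dilute BEC for hollow-core potentials. See
`HollowCoreCondensation` and `hollowCoreCondensation_of_reservoirRemoval`.
[cite: LSSY2005, Ch. 5 p. 42 (open)] -/
theorem stub_hollowCoreCondensation : HollowCoreCondensation := by
  sorry

/-! ## §2 The assembly (sorry-free) -/

/-- **Assembly (registered skeleton theorem).** The crux `ReservoirRemoval` BY NAME from the three
pieces: dichotomy on `HollowCore v`; hollow ⇒ Piece 3 outright (the pinned hypothesis is not
needed — and at large `κ` it is provably true, so nothing is lost); not hollow ⇒ Piece 2 bounds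
the reservoir and Piece 1 removes it. Pure logic; axioms `propext`, `Classical.choice`,
`Quot.sound` only. -/
theorem ReservoirRemoval_of :
    BoundedReservoirRemoval → ReservoirCapacity → HollowCoreCondensation → ReservoirRemoval := by
  intro h₁ h₂ h₃ v hv
  by_cases hH : HollowCore v
  · obtain ⟨ρ₀, hρ₀, h⟩ := h₃ v hv hH
    exact ⟨ρ₀, hρ₀, fun ρ w κ hρ hρlt hw hκ _ => h ρ hρ hρlt⟩
  · obtain ⟨ρ₁, hρ₁, h₁'⟩ := h₁ v hv
    obtain ⟨ρ₂, hρ₂, h₂'⟩ := h₂ v hv hH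
    refine ⟨min ρ₁ ρ₂, lt_min hρ₁ hρ₂, fun ρ w κ hρ hρlt hw hκ hyp => ?_⟩
    exact h₁' ρ w κ hρ (hρlt.trans_le (min_le_left _ _)) hw hκ
      (h₂' ρ w κ hρ (hρlt.trans_le (min_le_right _ _)) hw hκ) hyp

/-- The composition closes the crux from the declared stubs (`sorry` enters only through them). -/
theorem reservoirRemoval_of_stubs : ReservoirRemoval :=
  ReservoirRemoval_of stub_boundedReservoirRemoval stub_reservoirCapacity
    stub_hollowCoreCondensation

/-! ## §3 Why the residue is forced: the comb saturates the pinning for hollow cores -/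

/-- **Comb saturation** (paper lemma, NOT a stub and not used by the assembly; recorded as the
reason Piece 3 cannot be dropped): for a hollow-core admissible `v`, every density and every shell
width, there is a pinning threshold `κ₀` and `c > 0` such that for all `κ ≥ κ₀` the antecedent of
the crux holds with constant `c` — the comb state (all particles condensed in a lattice of
disjoint `C¹` bumps of radius `< min(r₀,w)/2` inside the shell, spacing `≥ R₀ + 2r`) has zero
interaction, kinetic energy `N‖∇φ_r‖²` and `⟨g,γg⟩ = fN`, so every `1`-near-minimiser of the
pinned functional has `⟨g,γ_Ψ g⟩ ≥ (f/2)N` once `κ f ≥ 4‖∇φ_r‖²`, and `λ_max ≥ ⟨g,γg⟩`.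
Ingredients all in the tree's style (`TrialState.nonempty_one` bumps, `BoseGasProductState`,
`occupation_le_maxOccupation`); size M to formalise. [folklore] -/
def CombSaturation : Prop :=
  ∀ v : ℝ → ℝ≥0∞, IsRepulsiveFiniteRange v → HollowCore v → ∀ ρ w : ℝ, 0 < ρ → 0 < w →
    ∃ κ₀ c : ℝ, 0 < κ₀ ∧ 0 < c ∧ ∀ κ : ℝ, κ₀ ≤ κ → PinnedBEC v ρ w κ c

/-- **The crux implies the residue** (modulo the paper lemma `CombSaturation`): for a hollow-core
`v`, saturate the pinning at `w = 1`, `κ = κ₀(v, ρ, 1)`; the crux then returns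
`HasGroundStateBEC v ρ` at every `ρ < ρ₀(v)`. Sorry-free; this is why `stub_hollowCoreCondensation`
is a NECESSARY piece of any proof of `ReservoirRemoval` as typed. [folklore] -/
theorem hollowCoreCondensation_of_reservoirRemoval :
    CombSaturation → ReservoirRemoval → HollowCoreCondensation := by
  intro hC hR v hv hH
  obtain ⟨ρ₀, hρ₀, hR'⟩ := hR v hv
  refine ⟨ρ₀, hρ₀, fun ρ hρ hρlt => ?_⟩
  obtain ⟨κ₀, c, hκ₀, hc, hsat⟩ := hC v hv hH ρ 1 hρ one_pos
  exact hR' ρ 1 κ₀ hρ hρlt one_pos hκ₀ ⟨c, hc, hsat κ₀ le_rfl⟩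

/-- Conversely the three pieces are individually weaker than, or independent of, the crux:
Piece 1 is the crux with an extra hypothesis, Piece 3 is a consequence of the crux (above) and of
the summit, Piece 2 is an energy/geometry statement with no condensation content. Recorded for the
BC3 probes (`bc/probes_*.lean` in the seat folder, results in `Lines/birth.md`:
`Piece → ReservoirRemoval` and `Piece → BoseEinsteinCondensation` fail for all three pieces under
`exact? | simpa | simpa [Piece] | (unfold Piece; simpa) | aesop`, 30/30 single-tactic probes). -/
theorem boundedReservoirRemoval_of_reservoirRemoval :
    ReservoirRemoval → BoundedReservoirRemoval := by
  intro hR v hv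
  obtain ⟨ρ₀, hρ₀, h⟩ := hR v hv
  exact ⟨ρ₀, hρ₀, fun ρ w κ hρ hρlt hw hκ _ hyp => h ρ w κ hρ hρlt hw hκ hyp⟩

/-! ## §4 The dichotomy is not degenerate (both classes are inhabited by admissible potentials) -/

/-- The free gas is hollow-core (and admissible): Piece 3 at `v = 0` is the tree theorem
`hasGroundStateBEC_zero`. [folklore] -/
theorem hollowCore_zero : HollowCore 0 :=
  ⟨1, one_pos, Filter.Eventually.of_forall fun _ _ => rfl⟩

/-- The unit soft sphere `v = 1_{[0,1]}` (admissible) is NOT hollow-core: Piece 2 applies to it.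
[folklore] -/
theorem not_hollowCore_softSphere :
    ¬ HollowCore (Set.indicator (Set.Icc (0 : ℝ) 1) (fun _ => (1 : ℝ≥0∞))) := by
  rintro ⟨r₀, hr₀, hae⟩
  rw [MeasureTheory.ae_iff] at hae
  have hsub : Set.Ioo (0 : ℝ) (min r₀ 1) ⊆
      {r : ℝ | ¬ (r ∈ Set.Ioo 0 r₀ → Set.indicator (Set.Icc (0 : ℝ) 1) (fun _ => (1 : ℝ≥0∞)) r = 0)} := by
    intro r hr
    simp only [Set.mem_Ioo, lt_min_iff] at hr
    simp only [Set.mem_setOf_eq, Set.mem_Ioo, Classical.not_imp]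
    refine ⟨⟨hr.1, hr.2.1⟩, ?_⟩
    rw [Set.indicator_of_mem (Set.mem_Icc.2 ⟨hr.1.le, hr.2.2.le⟩)]
    exact one_ne_zero
  have h0 : volume (Set.Ioo (0 : ℝ) (min r₀ 1)) = 0 := measure_mono_null hsub hae
  rw [Real.volume_Ioo] at h0
  have : (0 : ℝ) < min r₀ 1 - 0 := by simp [hr₀]
  exact absurd h0 (ENNReal.ofReal_pos.2 this).ne'

/-- The unit soft sphere is admissible (measurable, range `1`). [folklore] -/
theorem isRepulsiveFiniteRange_softSphere :
    IsRepulsiveFiniteRange (Set.indicator (Set.Icc (0 : ℝ) 1) (fun _ => (1 : ℝ≥0∞))) :=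
  ⟨(measurable_const.indicator measurableSet_Icc), 1, fun r hr =>
    Set.indicator_of_notMem (fun h => (not_le.2 hr) (Set.mem_Icc.1 h).2) _⟩

/-- The soft shell `v = 1_{[1,2]}` (admissible, genuinely interacting) IS hollow-core: the residue
class is not just the free gas. [folklore] -/
theorem hollowCore_softShell :
    HollowCore (Set.indicator (Set.Icc (1 : ℝ) 2) (fun _ => (1 : ℝ≥0∞))) :=
  ⟨1, one_pos, Filter.Eventually.of_forall fun r hr =>
    Set.indicator_of_notMem (fun h => (not_lt.2 (Set.mem_Icc.1 h).1) hr.2) _⟩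

end Summit.AtomisticToContinuum.BoseEinsteinCondensation.Cruxes.ReservoirRemoval.Birth

end
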